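import Literature.AnabelianGeometry.AbsoluteAnabelian.MonoidKummerMapsTLGLiftReduction
import Literature.AnabelianGeometry.AbsoluteAnabelian.MonoidKummerModelCompactProofs
import Literature.AnabelianGeometry.AbsoluteAnabelian.MonoidKummerMapsUnitFibresProofs
import HarnessLib

/-!
# [AbsTopIII] Prop 3.2 (iv) / 3.3 (ii): for COMPACT `Π` the lifting sentences need only the
# TOPOLOGICAL bi-anabelian statement for `k̄^×` (no continuity-of-abstract-isomorphisms input)

Proof-only companion (theorems only, no new definitions) of `MonoidKummerMaps.lean` (abc-iut-L4-t2)
and of abc-iut-L6-d1's `MonoidKummerMapsTLGLiftReduction.lean` (S. Mochizuki, *Topics in Absolute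
Anabelian Geometry III*, Def. 3.1 (i)/(ii) pp. 66–67, Prop. 3.2 (iv) p. 72 with proof pp. 72–73,
Prop. 3.3 (ii) p. 74; kurims manuscript, lit key `paper:url-5493eb38cbb7`).  Seat abc-iut-L6-t13
(RQ7 second pass of p413959 / p413741 with kernel probes).

`MonoidKummerMapsTLGLiftReduction` reduces every surjectivity sentence of Prop. 3.2 (iv) / 3.3 (ii) to
ONE field-level statement, in two strengths:
(BA) — for isomorphisms of TOPOLOGICAL groups `α : Gal(k̄₁/k₁) ⥲ Gal(k̄₂/k₂)` (the statement local
class field theory proves, [AbsAnab] Prop. 1.2.1 (iii)(iv)); and (BA_abs) — for ABSTRACT group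
isomorphisms `α`, which is (BA) plus "abstract isomorphisms between absolute Galois groups of MLFs are
continuous" (Nikolov–Segal / Jannsen–Wingberg strength).  The abstract strength enters only because
Def. 3.1 (i) — faithfully typed by `ModelMLFGaloisData` — asks of `ε_k : Π_k ↠ G_k` no more than
continuity and surjectivity, so that the Galois isomorphism `α` covered by an admissible
`f : Π ⥲ Π*` (`exists_galoisMulEquiv_of_map_ker_eq`) is a priori only an abstract one.

This file records that the extra strength is NOT needed whenever the augmentations are OPEN maps — in
particular whenever `Π` is COMPACT (profinite: the étale fundamental groups of the hyperbolic
orbicurves of Prop. 3.2 (iv), and `Π = G_k` itself), by abc-iut's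
`ModelMLFGaloisData.isOpenMap_aug_of_compactSpace`:

* `ModelMLFGaloisData.exists_galoisContinuousMulEquiv_of_isOpenMap` — for model data with OPEN
  `ε₁, ε₂`, an admissible `f : Π₁ ⥲ Π₂` covers an isomorphism of TOPOLOGICAL Galois groups;
* `tlgLifting_compact_of_biAnabelianUnits` — (BA) ⇒ the `TLG` lifting sentence for all MLF-Galois
  `TLG`-pairs with compact `Π`;
* `galoisIsoLiftsToTMPairIso_of_biAnabelianUnits_of_compact` — (BA) ⇒ abc-iut-L4-t2's named fact
  `GaloisIsoLiftsToTMPairIso H` for EVERY hypothesis predicate `H` that forces `Π` compact (the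
  intended instance "of hyperbolic orbicurve type": `Π` a profinite étale fundamental group);
* `tcgLifting_compact_of_biAnabelianUnits`, `unitPairIsoFibresOfType_of_biAnabelianUnits_of_compact`
  — the same for the `TCG` lifting sentence and for the corrected Prop. 3.3 (ii) schema
  `UnitPairIsoFibresOfType H` (with abc-iut-L6-t21's two-lift theorem).

So, for compact `Π`, the assumption surface of Prop. 3.2 (iv) / 3.3 (ii) in the tree is exactly (BA),
the statement STAGE 2 of abc-iut-L6-d1's row derives from the tree's local class field theory.

HONEST FRAMING: OUR kernel check of a reduction between statements of refereed papers; nothing here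
bears on [IUTchIII] Cor. 3.12.
-/

noncomputable section

open scoped Classical nonZeroDivisors

namespace Literature.AnabelianGeometry.AbsoluteAnabelian

/-! ### §1. Model level: open augmentations ⇒ the covered Galois isomorphism is continuous -/

section Model

variable {C₁ C₂ : MLFClosure.{0}} (D₁ : ModelMLFGaloisData C₁.k C₁.K) (D₂ : ModelMLFGaloisData C₂.k C₂.K)

/-- If the augmentations `ε₁ : Π₁ ↠ Gal(k̄₁/k₁)`, `ε₂ : Π₂ ↠ Gal(k̄₂/k₂)` are OPEN maps, then every
admissible `f : Π₁ ⥲ Π₂` (one carrying `Ker ε₁` onto `Ker ε₂`) covers an isomorphism of TOPOLOGICAL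
groups `α : Gal(k̄₁/k₁) ⥲ Gal(k̄₂/k₂)`, `α ∘ ε₁ = ε₂ ∘ f`: the preimage under `α` of an open set is
the `ε₁`-image of an open set.  (Def. 3.1 (ii): the arithmetic Galois group is "the quotient `Π ↠ G`
determined by the action"; for open `ε_k` this quotient carries the Krull topology.)
[cite: MochizukiAbsTopIII2015, Definition 3.1 (ii) p.67] -/
theorem ModelMLFGaloisData.exists_galoisContinuousMulEquiv_of_isOpenMap
    (h₁ : IsOpenMap D₁.aug) (h₂ : IsOpenMap D₂.aug) (f : D₁.Pi ≃ₜ* D₂.Pi)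
    (hf : D₁.aug.ker.map f.toMulEquiv.toMonoidHom = D₂.aug.ker) :
    ∃ α : (C₁.K ≃ₐ[C₁.k] C₁.K) ≃ₜ* (C₂.K ≃ₐ[C₂.k] C₂.K), ∀ g, α (D₁.aug g) = D₂.aug (f g) := by
  obtain ⟨α, hα⟩ := ModelMLFGaloisData.exists_galoisMulEquiv_of_map_ker_eq D₁ D₂ f hf
  -- `α` on `ε₁`-images and `α⁻¹` on `ε₂`-images
  have hαs : ∀ g, α.symm (D₂.aug g) = D₁.aug (f.symm g) := fun g => by
    rw [MulEquiv.symm_apply_eq, hα, ContinuousMulEquiv.apply_symm_apply]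
  -- preimages under `α`, `α⁻¹` are images under the open maps `ε₁`, `ε₂`
  have hpre : ∀ V : Set (C₂.K ≃ₐ[C₂.k] C₂.K), α ⁻¹' V = D₁.aug '' (f ⁻¹' (D₂.aug ⁻¹' V)) := by
    intro V
    ext σ
    constructor
    · intro hσ
      obtain ⟨g, rfl⟩ := D₁.aug_surjective σ
      refine ⟨g, ?_, rfl⟩
      show D₂.aug (f g) ∈ V
      rw [← hα]
      exact hσ
    · rintro ⟨g, hg, rfl⟩
      show α (D₁.aug g) ∈ V
      rw [hα]
      exact hg
  have hpre' : ∀ V : Set (C₁.K ≃ₐ[C₁.k] C₁.K), α.symm ⁻¹' V = D₂.aug '' (f.symm ⁻¹' (D₁.aug ⁻¹' V)) := by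
    intro V
    ext τ
    constructor
    · intro hτ
      obtain ⟨g, rfl⟩ := D₂.aug_surjective τ
      refine ⟨g, ?_, rfl⟩
      show D₁.aug (f.symm g) ∈ V
      rw [← hαs]
      exact hτ
    · rintro ⟨g, hg, rfl⟩
      show α.symm (D₂.aug g) ∈ V
      rw [hαs]
      exact hg
  refine ⟨{ α with continuous_toFun := ?_, continuous_invFun := ?_ }, hα⟩
  · show Continuous α
    rw [continuous_def]
    intro V hV
    rw [hpre V]
    exact h₁ _ ((hV.preimage D₂.continuous_aug).preimage f.continuous)
  · show Continuous α.symm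
    rw [continuous_def]
    intro V hV
    rw [hpre' V]
    exact h₂ _ ((hV.preimage D₁.continuous_aug).preimage f.symm.continuous)

/-- For model data with COMPACT `Π₁`, `Π₂` (e.g. profinite), every admissible `f : Π₁ ⥲ Π₂` covers an
isomorphism of TOPOLOGICAL Galois groups (the augmentations are then open:
`isOpenMap_aug_of_compactSpace`). [cite: MochizukiAbsTopIII2015, Definition 3.1 (ii) p.67] -/
theorem ModelMLFGaloisData.exists_galoisContinuousMulEquiv_of_compactSpace
    [CompactSpace D₁.Pi] [CompactSpace D₂.Pi] (f : D₁.Pi ≃ₜ* D₂.Pi)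
    (hf : D₁.aug.ker.map f.toMulEquiv.toMonoidHom = D₂.aug.ker) :
    ∃ α : (C₁.K ≃ₐ[C₁.k] C₁.K) ≃ₜ* (C₂.K ≃ₐ[C₂.k] C₂.K), ∀ g, α (D₁.aug g) = D₂.aug (f g) :=
  ModelMLFGaloisData.exists_galoisContinuousMulEquiv_of_isOpenMap D₁ D₂
    D₁.isOpenMap_aug_of_compactSpace D₂.isOpenMap_aug_of_compactSpace f hf

end Model

/-! ### §2. Pair level: the lifting sentences for compact `Π` from the TOPOLOGICAL (BA) -/

/-- **`TLG` lifting for compact `Π` FROM (BA).**  If every isomorphism of TOPOLOGICAL absolute Galois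
groups of MLFs lifts to an equivariant multiplicative bijection of the `k̄^×`, then every admissible
`Π ⥲ Π*` between MLF-Galois `TLG`-pairs WITH COMPACT underlying groups lifts to an isomorphism of pairs
(no continuity-of-abstract-isomorphisms input). [cite: MochizukiAbsTopIII2015, Proposition 3.3 (ii) p.74] -/
theorem tlgLifting_compact_of_biAnabelianUnits
    (hBA : ∀ (C₁ C₂ : MLFClosure.{0}) (α : (C₁.K ≃ₐ[C₁.k] C₁.K) ≃ₜ* (C₂.K ≃ₐ[C₂.k] C₂.K)),
      ∃ β : (C₁.K)⁰ ≃* (C₂.K)⁰, ∀ (σ : C₁.K ≃ₐ[C₁.k] C₁.K) (x y : (C₁.K)⁰), (y : C₁.K) = σ x →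
        ((β y : (C₂.K)⁰) : C₂.K) = α σ ((β x : (C₂.K)⁰) : C₂.K))
    (P Q : GaloisMonoidPair.{0}) (hP : IsMLFGaloisMonoidPair .TLG P) (hQ : IsMLFGaloisMonoidPair .TLG Q)
    (hPc : CompactSpace P.Pi) (hQc : CompactSpace Q.Pi)
    (f : P.Pi ≃ₜ* Q.Pi) (hf : P.actionKer.map f.toMulEquiv.toMonoidHom = Q.actionKer) :
    ∃ e : GaloisMonoidPair.Iso P Q, e.isoPi = f := by
  obtain ⟨C₁, D₁, P₁, hP₁, ⟨ι₁⟩⟩ := hP.exists_model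
  obtain ⟨C₂, D₂, Q₂, hQ₂, ⟨ι₂⟩⟩ := hQ.exists_model
  rw [ModelMLFGaloisData.monoidPair_TLG, Option.some.injEq] at hP₁ hQ₂
  subst hP₁
  subst hQ₂
  haveI : CompactSpace D₁.Pi := ι₁.isoPi.toHomeomorph.symm.compactSpace
  haveI : CompactSpace D₂.Pi := ι₂.isoPi.toHomeomorph.symm.compactSpace
  set f' : D₁.Pi ≃ₜ* D₂.Pi := ι₁.isoPi.trans (f.trans ι₂.isoPi.symm) with hf'
  have hf'k : D₁.aug.ker.map f'.toMulEquiv.toMonoidHom = D₂.aug.ker := by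
    have hcomp : f'.toMulEquiv.toMonoidHom = ι₂.isoPi.symm.toMulEquiv.toMonoidHom.comp
        (f.toMulEquiv.toMonoidHom.comp ι₁.isoPi.toMulEquiv.toMonoidHom) := MonoidHom.ext fun _ => rfl
    rw [← ModelMLFGaloisData.tlgPair_actionKer C₁ D₁, ← ModelMLFGaloisData.tlgPair_actionKer C₂ D₂, hcomp,
      ← Subgroup.map_map, ← Subgroup.map_map, ι₁.map_actionKer, hf, ι₂.symm_map_actionKer]
  obtain ⟨α, hα⟩ :=
    ModelMLFGaloisData.exists_galoisContinuousMulEquiv_of_compactSpace D₁ D₂ f' hf'k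
  obtain ⟨β, hβ⟩ := hBA C₁ C₂ α
  obtain ⟨e₁, he₁⟩ :=
    ModelMLFGaloisData.exists_tlgPair_iso_of_equivariant D₁ D₂ f' α.toMulEquiv hα β hβ
  refine ⟨⟨f, ι₁.isoM.symm.trans (e₁.isoM.trans ι₂.isoM), fun g x => ?_⟩, rfl⟩
  show ι₂.isoM (e₁.isoM (ι₁.isoM.symm (g • x))) = f g • ι₂.isoM (e₁.isoM (ι₁.isoM.symm x))
  rw [GaloisMonoidPair.Iso.symm_smul_comm, e₁.smul_comm, ι₂.smul_comm, he₁]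
  show ι₂.isoPi (ι₂.isoPi.symm (f (ι₁.isoPi (ι₁.isoPi.symm g)))) • _ = _
  rw [ContinuousMulEquiv.apply_symm_apply, ContinuousMulEquiv.apply_symm_apply]

/-- The `TLG` lifting sentence RELATIVE to the predicate "`Π` is compact", from (BA) — the shape the
relative reductions `galoisIsoLiftsToTMPairIso_of_tlgLifting_relative` /
`tcgLifting_of_tlgLifting_relative` consume. [cite: MochizukiAbsTopIII2015, Proposition 3.3 (ii) p.74] -/
theorem tlgLifting_relCompact_of_biAnabelianUnits
    (hBA : ∀ (C₁ C₂ : MLFClosure.{0}) (α : (C₁.K ≃ₐ[C₁.k] C₁.K) ≃ₜ* (C₂.K ≃ₐ[C₂.k] C₂.K)),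
      ∃ β : (C₁.K)⁰ ≃* (C₂.K)⁰, ∀ (σ : C₁.K ≃ₐ[C₁.k] C₁.K) (x y : (C₁.K)⁰), (y : C₁.K) = σ x →
        ((β y : (C₂.K)⁰) : C₂.K) = α σ ((β x : (C₂.K)⁰) : C₂.K)) :
    ∀ (P Q : GaloisMonoidPair.{0}), IsMLFGaloisMonoidPair .TLG P → IsMLFGaloisMonoidPair .TLG Q →
      CompactSpace P.Pi → CompactSpace Q.Pi → ∀ f : P.Pi ≃ₜ* Q.Pi,
        P.actionKer.map f.toMulEquiv.toMonoidHom = Q.actionKer →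
          ∃ e : GaloisMonoidPair.Iso P Q, e.isoPi = f :=
  fun P Q hP hQ hPc hQc f hf => tlgLifting_compact_of_biAnabelianUnits hBA P Q hP hQ hPc hQc f hf

/-- Compactness passes from a pair to the `TLG`-pair of any of its `TM`-models (the underlying groups are
homeomorphic). [cite: MochizukiAbsTopIII2015, Definition 3.1 (ii) p.67] -/
theorem ModelMLFGaloisData.compactSpace_tlgPair_of_tmPair_iso (C : MLFClosure.{0})
    (D : ModelMLFGaloisData C.k C.K) (P : GaloisMonoidPair.{0})
    (h : Nonempty (GaloisMonoidPair.Iso D.tmPair P)) (hP : CompactSpace P.Pi) :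
    CompactSpace D.tlgPair.Pi := by
  obtain ⟨ι⟩ := h
  exact ι.isoPi.toHomeomorph.symm.compactSpace

/-- Compactness passes from a pair to the `TLG`-pair of any of its `TCG`-models.
[cite: MochizukiAbsTopIII2015, Definition 3.1 (ii) p.67] -/
theorem ModelMLFGaloisData.compactSpace_tlgPair_of_tcgPair_iso (C : MLFClosure.{0})
    (D : ModelMLFGaloisData C.k C.K) (P : GaloisMonoidPair.{0})
    (h : Nonempty (GaloisMonoidPair.Iso D.tcgPair P)) (hP : CompactSpace P.Pi) :
    CompactSpace D.tlgPair.Pi := by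
  obtain ⟨ι⟩ := h
  exact ι.isoPi.toHomeomorph.symm.compactSpace

/-! ### §3. The named facts, for hypothesis predicates forcing compact `Π`, from (BA) -/

/-- **Prop 3.2 (iv) surjectivity schema (`TM`) FROM (BA), for compact `Π`.**  For EVERY hypothesis
predicate `H` on pairs that forces the underlying topological group to be compact — the intended
instance "of hyperbolic orbicurve type" (`Π` the PROFINITE étale fundamental group of a hyperbolic
orbicurve over `k`) is of this kind — abc-iut-L4-t2's named fact `GaloisIsoLiftsToTMPairIso H` follows from
the TOPOLOGICAL bi-anabelian statement (BA) alone (via abc-iut-L6-t21's relative `TM ⇐ TLG` reduction).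
[cite: MochizukiAbsTopIII2015, Proposition 3.2 (iv) p.72] [cite: MochizukiAbsTopIIIComments2019, item (5)] -/
theorem galoisIsoLiftsToTMPairIso_of_biAnabelianUnits_of_compact
    (hBA : ∀ (C₁ C₂ : MLFClosure.{0}) (α : (C₁.K ≃ₐ[C₁.k] C₁.K) ≃ₜ* (C₂.K ≃ₐ[C₂.k] C₂.K)),
      ∃ β : (C₁.K)⁰ ≃* (C₂.K)⁰, ∀ (σ : C₁.K ≃ₐ[C₁.k] C₁.K) (x y : (C₁.K)⁰), (y : C₁.K) = σ x →
        ((β y : (C₂.K)⁰) : C₂.K) = α σ ((β x : (C₂.K)⁰) : C₂.K))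
    (H : GaloisMonoidPair.{0} → Prop) (hH : ∀ P, H P → CompactSpace P.Pi) :
    GaloisIsoLiftsToTMPairIso H :=
  galoisIsoLiftsToTMPairIso_of_tlgLifting_relative H (fun P => CompactSpace P.Pi)
    (fun C D P hι hHP => ModelMLFGaloisData.compactSpace_tlgPair_of_tmPair_iso C D P hι (hH P hHP))
    (tlgLifting_relCompact_of_biAnabelianUnits hBA)

/-- **`TCG` lifting for compact `Π` FROM (BA)** (Prop. 3.3 (ii) with a hypothesis predicate forcing
compactness). [cite: MochizukiAbsTopIII2015, Proposition 3.3 (ii) p.74] -/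
theorem tcgLifting_compact_of_biAnabelianUnits
    (hBA : ∀ (C₁ C₂ : MLFClosure.{0}) (α : (C₁.K ≃ₐ[C₁.k] C₁.K) ≃ₜ* (C₂.K ≃ₐ[C₂.k] C₂.K)),
      ∃ β : (C₁.K)⁰ ≃* (C₂.K)⁰, ∀ (σ : C₁.K ≃ₐ[C₁.k] C₁.K) (x y : (C₁.K)⁰), (y : C₁.K) = σ x →
        ((β y : (C₂.K)⁰) : C₂.K) = α σ ((β x : (C₂.K)⁰) : C₂.K))
    (H : GaloisMonoidPair.{0} → Prop) (hH : ∀ P, H P → CompactSpace P.Pi)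
    (P Q : GaloisMonoidPair.{0}) (hP : IsMLFGaloisMonoidPair .TCG P) (hQ : IsMLFGaloisMonoidPair .TCG Q)
    (hHP : H P) (hHQ : H Q) (f : P.Pi ≃ₜ* Q.Pi)
    (hf : P.actionKer.map f.toMulEquiv.toMonoidHom = Q.actionKer) :
    ∃ e : GaloisMonoidPair.Iso P Q, e.isoPi = f :=
  tcgLifting_of_tlgLifting_relative H (fun P => CompactSpace P.Pi)
    (fun C D P hι hHP => ModelMLFGaloisData.compactSpace_tlgPair_of_tcgPair_iso C D P hι (hH P hHP))
    (tlgLifting_relCompact_of_biAnabelianUnits hBA) P Q hP hQ hHP hHQ f hf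

/-- **The corrected Prop 3.3 (ii) schema `UnitPairIsoFibresOfType H` FROM (BA), for compact `Π`**: for
every hypothesis predicate `H` forcing compactness, both conjuncts (the `TCG` lifting and the `TLG`
two-lift clause — abc-iut-L6-t21's `unitPairIso_fibre_two_of_exists_lift` applied to ONE lift) follow
from the topological bi-anabelian statement. [cite: MochizukiAbsTopIII2015, Proposition 3.3 (ii) p.74]
[cite: MochizukiAbsTopIIIComments2019, item (5)] -/
theorem unitPairIsoFibresOfType_of_biAnabelianUnits_of_compact
    (hBA : ∀ (C₁ C₂ : MLFClosure.{0}) (α : (C₁.K ≃ₐ[C₁.k] C₁.K) ≃ₜ* (C₂.K ≃ₐ[C₂.k] C₂.K)),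
      ∃ β : (C₁.K)⁰ ≃* (C₂.K)⁰, ∀ (σ : C₁.K ≃ₐ[C₁.k] C₁.K) (x y : (C₁.K)⁰), (y : C₁.K) = σ x →
        ((β y : (C₂.K)⁰) : C₂.K) = α σ ((β x : (C₂.K)⁰) : C₂.K))
    (H : GaloisMonoidPair.{0} → Prop) (hH : ∀ P, H P → CompactSpace P.Pi) :
    UnitPairIsoFibresOfType H :=
  unitPairIsoFibresOfType_of_tlgLifting_relative H (fun P => CompactSpace P.Pi)
    (fun C D P hι hHP => ModelMLFGaloisData.compactSpace_tlgPair_of_tcgPair_iso C D P hι (hH P hHP))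
    (tlgLifting_relCompact_of_biAnabelianUnits hBA)
    (fun P Q hP hQ hHP hHQ f hf =>
      unitPairIso_fibre_two_of_exists_lift P Q hP f
        (tlgLifting_compact_of_biAnabelianUnits hBA P Q hP hQ (hH P hHP) (hH Q hHQ) f hf))

end Literature.AnabelianGeometry.AbsoluteAnabelian

end
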